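import Literature.MathematicalPhysics.QuantumFieldTheory.YangMillsOS
import Literature.MathematicalPhysics.QuantumLattice.WilsonBlockHeatBathSemigroup
import Literature.MathematicalPhysics.QuantumLattice.WilsonBlockHeatBathLightCone2
import Literature.MathematicalPhysics.QuantumLattice.WilsonBlockHeatBathMarkov3
import Literature.MathematicalPhysics.QuantumLattice.TorusWilsonGibbs
import Summits.QuantumFields.YangMills.Theorems.EquipartitionCriticalityLatticeGapLargeBetaStubSpeciesClusteringGeometry

/-!
# Stub `stub_speciesClustering` of line `Sketch` (one-form Witten / IMS) for crux stmt-QuantumFields-8761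
(`Summit.QuantumFields.YangMills.Theses.EquipartitionCriticality.LatticeGapLargeBeta`)

Lipschitz covariance decay + Lipschitz kernel versions ⇒ per-β clustering of all species with a
β-independent observable weight.

Proof (the currency exchange of the line; no definition is introduced):
* Part I (abstract probability space): the pull-out property `∫ μ[f|m] g = ∫ f g` for bounded `f` and
  bounded `m`-measurable `g`, whence `∫ f g − ∫ f ∫ g = ∫ f' g' − ∫ f' ∫ g'` when `g` is `m₁`-measurable,
  `f' = μ[f|m₁]` a.e. is `m₂`-measurable and `g' = μ[g|m₂]` a.e. (`cov_eq_cov_versions`);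
* Part II (torus `(ℤ/(2S+1))⁴`, time = axis `0`, main regime `2(w_A+w_B)+8 ≤ n ≤ S`): write
  `corr = ∫ f g − ∫ f ∫ g` with `f = A ∘ lift`, `g = τ_n B ∘ lift`
  (`WilsonBlockHeatBath.latticeConnectedCorr_eq_integral_sub`, `shiftedObservable_props`); the projected
  supports `Λ_A, Λ_B` live in the time windows `[-w_A, w_A]`, `[n-w_B, n+w_B]`, their collars `T_A, T_B`
  (`exists_collar`, `≤ 64|Λ|` edges, all plaquettes meeting `Λ`) in the windows widened by `1`, so that
  `Λ_A ∪ T_A` and `Λ_B ∪ T_B` are disjoint and at cyclic separation `≥ k = n − 2(w_A+w_B) − 8`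
  (`sep_of_windows`, `ZMod` bookkeeping in the geometry file); replace `f, g` by the Lipschitz kernel
  versions `f', g'` of hypothesis P1 (Part I with `m₁ = 𝓕_{Λ_Aᶜ}`, `m₂ = 𝓕_{Λ_Bᶜ}`,
  `Measurable.measurable_cylinderEvents_of_dependsOn`) and apply hypothesis H to `(f', g', T_A, T_B)`
  (`abs_corr_le_main`);
* Part III: the a priori bound `2 C_A C_B` (`abs_latticeConnectedCorr_le_two_mul`) for small `n`, the rate
  `m = min μ 1`, the prefactor `K' = max K 0 · (max c 0)² + 1` and the `β`-independent weight
  `D(A,B) = 4096 (C_A C_B + 1)(|A|+1)(|B|+1) e^{2(w_A+w_B)+8}` (`final_bound`).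
-/

noncomputable section

open scoped BigOperators Topology
open MeasureTheory ProbabilityTheory Filter
open Literature.MathematicalPhysics.QuantumFieldTheory Literature.MathematicalPhysics.QuantumLattice
open Literature.MathematicalPhysics.QuantumLattice.WilsonBlockHeatBath

namespace Summit.QuantumFields.YangMills.Theorems.LatticeGapLargeBeta.WittenIMS

/-! ## Part I: covariance through versions of conditional expectations -/
section Abstract

variable {Ω : Type*} {m₁ m₂ : MeasurableSpace Ω} {m0 : MeasurableSpace Ω} {μ : Measure Ω}
  [IsFiniteMeasure μ]

/-- Pull-out property for bounded functions: `∫ μ[f|m₁] g = ∫ f g` for `m₁`-measurable bounded `g`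
and bounded `f` (finite measure). -/
theorem integral_condExp_mul_of_bdd (hm : m₁ ≤ m0) {f g : Ω → ℝ} (hf : AEStronglyMeasurable f μ)
    (hg : StronglyMeasurable[m₁] g) {Cf Cg : ℝ} (hCf : ∀ ω, |f ω| ≤ Cf) (hCg : ∀ ω, |g ω| ≤ Cg) :
    ∫ ω, (μ[f|m₁]) ω * g ω ∂μ = ∫ ω, f ω * g ω ∂μ := by
  -- adapted from `SusceptibilityToPoincare.TwoBlock.integral_condExp_mul`
  have hg0 : AEStronglyMeasurable g μ := (hg.mono hm).aestronglyMeasurable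
  have hfi : Integrable f μ :=
    Integrable.of_bound hf Cf (ae_of_all _ fun ω => by rw [Real.norm_eq_abs]; exact hCf ω)
  have hfg : Integrable (f * g) μ :=
    hfi.mul_bdd hg0 (ae_of_all _ fun ω => by rw [Real.norm_eq_abs]; exact hCg ω)
  have hpull : μ[f * g|m₁] =ᵐ[μ] μ[f|m₁] * g := condExp_mul_of_stronglyMeasurable_right hg hfg hfi
  calc ∫ ω, (μ[f|m₁]) ω * g ω ∂μ = ∫ ω, (μ[f|m₁] * g) ω ∂μ := rfl
    _ = ∫ ω, (μ[f * g|m₁]) ω ∂μ := (integral_congr_ae hpull).symm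
    _ = ∫ ω, (f * g) ω ∂μ := integral_condExp hm
    _ = ∫ ω, f ω * g ω ∂μ := rfl

/-- **Covariance through versions of conditional expectations.** If `g` is `m₁`-measurable, `f'` is an
`m₂`-measurable version of `μ[f|m₁]` and `g'` is a version of `μ[g|m₂]` (everything bounded, finite
measure), then `∫ f g − ∫ f ∫ g = ∫ f' g' − ∫ f' ∫ g'` (pull-out twice, `∫ μ[·|m] = ∫ ·`). -/
theorem cov_eq_cov_versions (hm₁ : m₁ ≤ m0) (hm₂ : m₂ ≤ m0) {f g f' g' : Ω → ℝ}
    (hf : AEStronglyMeasurable f μ) (hg : AEStronglyMeasurable g μ)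
    (hg₁ : StronglyMeasurable[m₁] g) (hf'₂ : StronglyMeasurable[m₂] f')
    {Cf Cg Cf' : ℝ} (hCf : ∀ ω, |f ω| ≤ Cf) (hCg : ∀ ω, |g ω| ≤ Cg) (hCf' : ∀ ω, |f' ω| ≤ Cf')
    (h1 : f' =ᵐ[μ] μ[f|m₁]) (h2 : g' =ᵐ[μ] μ[g|m₂]) :
    (∫ ω, f ω * g ω ∂μ) - (∫ ω, f ω ∂μ) * ∫ ω, g ω ∂μ =
      (∫ ω, f' ω * g' ω ∂μ) - (∫ ω, f' ω ∂μ) * ∫ ω, g' ω ∂μ := by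
  have e1 : ∫ ω, f ω * g ω ∂μ = ∫ ω, f' ω * g ω ∂μ := by
    rw [← integral_condExp_mul_of_bdd hm₁ hf hg₁ hCf hCg]
    refine integral_congr_ae ?_
    filter_upwards [h1] with ω hω
    rw [hω]
  have e2 : ∫ ω, f' ω * g ω ∂μ = ∫ ω, f' ω * g' ω ∂μ := by
    calc ∫ ω, f' ω * g ω ∂μ = ∫ ω, g ω * f' ω ∂μ :=
          integral_congr_ae (Eventually.of_forall fun ω => mul_comm (f' ω) (g ω))
      _ = ∫ ω, (μ[g|m₂]) ω * f' ω ∂μ := (integral_condExp_mul_of_bdd hm₂ hg hf'₂ hCg hCf').symm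
      _ = ∫ ω, g' ω * f' ω ∂μ := by
          refine integral_congr_ae ?_
          filter_upwards [h2] with ω hω
          rw [hω]
      _ = ∫ ω, f' ω * g' ω ∂μ := integral_congr_ae (Eventually.of_forall fun ω => mul_comm (g' ω) (f' ω))
  have e3 : ∫ ω, f ω ∂μ = ∫ ω, f' ω ∂μ := by
    rw [← integral_condExp hm₁ (f := f) (μ := μ)]
    refine integral_congr_ae ?_
    filter_upwards [h1] with ω hω
    rw [hω]
  have e4 : ∫ ω, g ω ∂μ = ∫ ω, g' ω ∂μ := by
    rw [← integral_condExp hm₂ (f := g) (μ := μ)]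
    refine integral_congr_ae ?_
    filter_upwards [h2] with ω hω
    rw [hω]
  rw [e1, e2, e3, e4]

end Abstract

/-! ## Part II: the main regime on the torus -/
section Lattice

variable {G : Type} [Group G] [TopologicalSpace G] [IsTopologicalGroup G] [CompactSpace G]
  [MeasurableSpace G] [BorelSpace G]

/-- **Main regime** (`2(w_A + w_B) + 8 ≤ n ≤ S`): replace `A ∘ lift` and `τ_n B ∘ lift` by their Lipschitz
kernel versions on the collars of the projected supports (pull-out twice; supports and collars are
time-separated) and apply the Lipschitz covariance decay at cyclic separation `n − 2(w_A + w_B) − 8`. -/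
theorem abs_corr_le_main (r : LatticeRep G) (β : ℝ) {c μr K : ℝ} {S n : ℕ} (A B : YMSpecies G)
    {CA CB : ℝ} (hCA : ∀ U, |A.F U| ≤ CA) (hCB : ∀ U, |B.F U| ≤ CB) {wA wB : ℕ}
    (hwA : ∀ e ∈ A.supp, (e.1 0).natAbs ≤ wA) (hwB : ∀ e ∈ B.supp, (e.1 0).natAbs ≤ wB)
    (hc : ∀ (Λ T : Finset (Edge 4 (2 * S + 1))), Disjoint Λ T →
      (∀ (y : Site 4 (2 * S + 1)) (i j : Fin 4), i < j →
        (({(y, i), (y.shift i, j), (y.shift j, i), (y, j)} : Finset (Edge 4 (2 * S + 1))) ∩ Λ).Nonempty →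
        (↑({(y, i), (y.shift i, j), (y.shift j, i), (y, j)} : Finset (Edge 4 (2 * S + 1))) :
          Set (Edge 4 (2 * S + 1))) ⊆ ↑Λ ∪ ↑T) →
      ∀ (f : GaugeConfig 4 (2 * S + 1) G → ℝ) (M : ℝ), Measurable f → (∀ U, |f U| ≤ M) →
        DependsOn f (↑Λ : Set (Edge 4 (2 * S + 1))) →
      ∃ f' : GaugeConfig 4 (2 * S + 1) G → ℝ, Measurable f' ∧ (∀ U, |f' U| ≤ M) ∧
        DependsOn f' (↑T : Set (Edge 4 (2 * S + 1))) ∧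
        (∀ (U : GaugeConfig 4 (2 * S + 1) G) (e : Edge 4 (2 * S + 1)) (h : G),
          |f' (Function.update U e h) - f' U| ≤
            c * M * Real.sqrt (∑ a, ∑ b, ‖(r.ρ h - r.ρ (U e)) a b‖ ^ 2)) ∧
        f' =ᵐ[(wilsonMeasure r.ρ β : Measure (GaugeConfig 4 (2 * S + 1) G))]
          (wilsonMeasure r.ρ β : Measure (GaugeConfig 4 (2 * S + 1) G))[f | cylinderEvents
            (X := fun _ : Edge 4 (2 * S + 1) => G) ((↑Λ : Set (Edge 4 (2 * S + 1)))ᶜ)])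
    (hK : ∀ (f g : GaugeConfig 4 (2 * S + 1) G → ℝ) (Λf Λg : Finset (Edge 4 (2 * S + 1))) (Kf Kg : ℝ),
        0 ≤ Kf → 0 ≤ Kg → Measurable f → Measurable g →
        (∃ M : ℝ, ∀ U, |f U| ≤ M) → (∃ M : ℝ, ∀ U, |g U| ≤ M) →
        DependsOn f (↑Λf : Set (Edge 4 (2 * S + 1))) → DependsOn g (↑Λg : Set (Edge 4 (2 * S + 1))) →
        (∀ (U : GaugeConfig 4 (2 * S + 1) G) (e : Edge 4 (2 * S + 1)) (h : G),
          |f (Function.update U e h) - f U| ≤ Kf * Real.sqrt (∑ a, ∑ b, ‖(r.ρ h - r.ρ (U e)) a b‖ ^ 2)) →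
        (∀ (U : GaugeConfig 4 (2 * S + 1) G) (e : Edge 4 (2 * S + 1)) (h : G),
          |g (Function.update U e h) - g U| ≤ Kg * Real.sqrt (∑ a, ∑ b, ‖(r.ρ h - r.ρ (U e)) a b‖ ^ 2)) →
      ∀ k : ℕ, (∀ e ∈ Λf, ∀ e' ∈ Λg, k ≤ (e.1 0 - e'.1 0).val ∧ k ≤ (e'.1 0 - e.1 0).val) →
        |(∫ U, f U * g U ∂(wilsonMeasure r.ρ β : Measure (GaugeConfig 4 (2 * S + 1) G))) -
            (∫ U, f U ∂(wilsonMeasure r.ρ β : Measure (GaugeConfig 4 (2 * S + 1) G))) *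
              ∫ U, g U ∂(wilsonMeasure r.ρ β : Measure (GaugeConfig 4 (2 * S + 1) G))| ≤
          K * Kf * Kg * Λf.card * Λg.card * Real.exp (-(μr * k)))
    (hn₀ : 2 * (wA + wB) + 8 ≤ n) (hnS : n ≤ S) :
    |latticeConnectedCorr r.ρ β (2 * S + 1) A.F B.F n| ≤
      max K 0 * ((max c 0) ^ 2 * (CA * CB) * ((64 * A.supp.card) * (64 * B.supp.card))) *
        Real.exp (-(μr * (n - (2 * (wA + wB) + 8) : ℕ))) := by
  classical
  haveI : IsProbabilityMeasure (wilsonMeasure (d := 4) (L := 2 * S + 1) r.ρ β) :=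
    isProbabilityMeasure_wilsonMeasure (d := 4) (L := 2 * S + 1) r.ρ r.continuous β
  have hCA0 : 0 ≤ CA := (abs_nonneg _).trans (hCA 1)
  have hCB0 : 0 ≤ CB := (abs_nonneg _).trans (hCB 1)
  have hc0 : 0 ≤ max c 0 := le_max_right _ _
  obtain ⟨hfm, -, -, hfdep⟩ := shiftedObservable_props A ((0 : ℕ) : ℤ) (2 * S + 1)
  obtain ⟨hgm, -, -, hgdep⟩ := shiftedObservable_props B ((n : ℕ) : ℤ) (2 * S + 1)
  -- the projected supports and their time windows
  have hΛAcard : (A.supp.image fun e => torusEdge (2 * S + 1) (e.1 + Pi.single 0 ((0 : ℕ) : ℤ), e.2)).card ≤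
      A.supp.card := Finset.card_image_le
  have hΛBcard : (B.supp.image fun e => torusEdge (2 * S + 1) (e.1 + Pi.single 0 ((n : ℕ) : ℤ), e.2)).card ≤
      B.supp.card := Finset.card_image_le
  have htA0 := exists_time_of_mem_image (N := 2 * S + 1) A ((0 : ℕ) : ℤ) hwA
  have htB0 := exists_time_of_mem_image (N := 2 * S + 1) B ((n : ℕ) : ℤ) hwB
  generalize (A.supp.image fun e => torusEdge (2 * S + 1) (e.1 + Pi.single 0 ((0 : ℕ) : ℤ), e.2)) = ΛA
    at hfdep hΛAcard htA0
  generalize (B.supp.image fun e => torusEdge (2 * S + 1) (e.1 + Pi.single 0 ((n : ℕ) : ℤ), e.2)) = ΛB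
    at hgdep hΛBcard htB0
  -- collars
  obtain ⟨TA, hdA, hcolA, hcardA, hadjA⟩ := exists_collar ΛA
  obtain ⟨TB, hdB, hcolB, hcardB, hadjB⟩ := exists_collar ΛB
  have htA := exists_time_of_union htA0 hadjA
  have htB := exists_time_of_union htB0 hadjB
  -- separation of `ΛA ∪ TA` from `ΛB ∪ TB`
  have hsep := sep_of_windows (S := S) (p := wA + 1) (q := wB + 1) (n := n) (k := n - (2 * (wA + wB) + 8))
    (by omega) (by omega) (by omega) (by omega) (Nat.cast_zero) rfl htA htB
  have hsubB : (↑ΛB : Set (Edge 4 (2 * S + 1))) ⊆ (↑ΛA : Set (Edge 4 (2 * S + 1)))ᶜ := fun e heB heA =>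
    (hsep e (Finset.mem_union_left _ (Finset.mem_coe.1 heA)) e
      (Finset.mem_union_left _ (Finset.mem_coe.1 heB))).1 rfl
  have hsubA : (↑TA : Set (Edge 4 (2 * S + 1))) ⊆ (↑ΛB : Set (Edge 4 (2 * S + 1)))ᶜ := fun e heT heB =>
    (hsep e (Finset.mem_union_right _ (Finset.mem_coe.1 heT)) e
      (Finset.mem_union_left _ (Finset.mem_coe.1 heB))).1 rfl
  -- the Lipschitz kernel versions
  obtain ⟨f', hf'm, hf'b, hf'dep, hf'lip, hf'ae⟩ := hc ΛA TA hdA hcolA _ CA hfm (fun U => hCA _) hfdep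
  obtain ⟨g', hg'm, hg'b, hg'dep, hg'lip, hg'ae⟩ := hc ΛB TB hdB hcolB _ CB hgm (fun U => hCB _) hgdep
  -- pull-out twice
  have hg₁ : StronglyMeasurable[cylinderEvents (X := fun _ : Edge 4 (2 * S + 1) => G)
      ((↑ΛA : Set (Edge 4 (2 * S + 1)))ᶜ)]
      (fun U : GaugeConfig 4 (2 * S + 1) G =>
        B.F (configShift (-Pi.single 0 ((n : ℕ) : ℤ)) (torusLift (2 * S + 1) U))) :=
    (hgm.measurable_cylinderEvents_of_dependsOn (hgdep.mono hsubB)).stronglyMeasurable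
  have hf'₂ : StronglyMeasurable[cylinderEvents (X := fun _ : Edge 4 (2 * S + 1) => G)
      ((↑ΛB : Set (Edge 4 (2 * S + 1)))ᶜ)] f' :=
    (hf'm.measurable_cylinderEvents_of_dependsOn (hf'dep.mono hsubA)).stronglyMeasurable
  have hcov := cov_eq_cov_versions (μ := wilsonMeasure (d := 4) (L := 2 * S + 1) r.ρ β)
    cylinderEvents_le_pi cylinderEvents_le_pi hfm.aestronglyMeasurable hgm.aestronglyMeasurable hg₁ hf'₂
    (fun U => hCA _) (fun U => hCB _) hf'b hf'ae hg'ae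
  refine (congrArg abs ((latticeConnectedCorr_eq_integral_sub r.ρ β (2 * S + 1) A.F B.F n).trans
    hcov)).trans_le ?_
  -- the Lipschitz covariance decay
  have hlipf : ∀ (U : GaugeConfig 4 (2 * S + 1) G) (e : Edge 4 (2 * S + 1)) (h : G),
      |f' (Function.update U e h) - f' U| ≤
        max c 0 * CA * Real.sqrt (∑ a, ∑ b, ‖(r.ρ h - r.ρ (U e)) a b‖ ^ 2) := fun U e h =>
    (hf'lip U e h).trans (mul_le_mul_of_nonneg_right
      (mul_le_mul_of_nonneg_right (le_max_left c 0) hCA0) (Real.sqrt_nonneg _))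
  have hlipg : ∀ (U : GaugeConfig 4 (2 * S + 1) G) (e : Edge 4 (2 * S + 1)) (h : G),
      |g' (Function.update U e h) - g' U| ≤
        max c 0 * CB * Real.sqrt (∑ a, ∑ b, ‖(r.ρ h - r.ρ (U e)) a b‖ ^ 2) := fun U e h =>
    (hg'lip U e h).trans (mul_le_mul_of_nonneg_right
      (mul_le_mul_of_nonneg_right (le_max_left c 0) hCB0) (Real.sqrt_nonneg _))
  have key := hK f' g' TA TB (max c 0 * CA) (max c 0 * CB) (by positivity) (by positivity) hf'm hg'm
    ⟨CA, hf'b⟩ ⟨CB, hg'b⟩ hf'dep hg'dep hlipf hlipg (n - (2 * (wA + wB) + 8))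
    (fun e he e' he' => (hsep e (Finset.mem_union_right _ he) e' (Finset.mem_union_right _ he')).2)
  have hTA : (TA.card : ℝ) ≤ 64 * A.supp.card := by
    have h1 : TA.card ≤ 64 * A.supp.card := hcardA.trans (Nat.mul_le_mul_left 64 hΛAcard)
    exact_mod_cast h1
  have hTB : (TB.card : ℝ) ≤ 64 * B.supp.card := by
    have h1 : TB.card ≤ 64 * B.supp.card := hcardB.trans (Nat.mul_le_mul_left 64 hΛBcard)
    exact_mod_cast h1
  calc |(∫ U, f' U * g' U ∂(wilsonMeasure (d := 4) (L := 2 * S + 1) r.ρ β)) -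
          (∫ U, f' U ∂(wilsonMeasure (d := 4) (L := 2 * S + 1) r.ρ β)) *
            ∫ U, g' U ∂(wilsonMeasure (d := 4) (L := 2 * S + 1) r.ρ β)|
        ≤ K * (max c 0 * CA) * (max c 0 * CB) * TA.card * TB.card *
          Real.exp (-(μr * (n - (2 * (wA + wB) + 8) : ℕ))) := key
    _ = K * ((max c 0 * CA) * (max c 0 * CB) * TA.card * TB.card *
          Real.exp (-(μr * (n - (2 * (wA + wB) + 8) : ℕ)))) := by ring
    _ ≤ max K 0 * ((max c 0 * CA) * (max c 0 * CB) * TA.card * TB.card *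
          Real.exp (-(μr * (n - (2 * (wA + wB) + 8) : ℕ)))) :=
        mul_le_mul_of_nonneg_right (le_max_left K 0) (by positivity)
    _ ≤ max K 0 * ((max c 0) ^ 2 * (CA * CB) * ((64 * A.supp.card) * (64 * B.supp.card)) *
          Real.exp (-(μr * (n - (2 * (wA + wB) + 8) : ℕ)))) := by
        refine mul_le_mul_of_nonneg_left ?_ (le_max_right K 0)
        have e : (max c 0 * CA) * (max c 0 * CB) * TA.card * TB.card =
            (max c 0) ^ 2 * (CA * CB) * ((TA.card : ℝ) * TB.card) := by ring
        rw [e]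
        refine mul_le_mul_of_nonneg_right ?_ (Real.exp_pos _).le
        refine mul_le_mul_of_nonneg_left ?_ (by positivity)
        exact mul_le_mul hTA hTB (by positivity) (by positivity)
    _ = max K 0 * ((max c 0) ^ 2 * (CA * CB) * ((64 * A.supp.card) * (64 * B.supp.card))) *
          Real.exp (-(μr * (n - (2 * (wA + wB) + 8) : ℕ))) := (mul_assoc _ _ _).symm

end Lattice

/-! ## Part III: the two regimes and the `β`-independent weight -/

/-- **Numerical assembly of the two regimes.** From the a priori bound `x ≤ 2 C_A C_B` and the
main-regime bound for `n ≥ n₀ := 2(w_A + w_B) + 8`, the bound `x ≤ K' · D · e^{−m n}` with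
`m = min μ 1`, `K' = max K 0 · (max c 0)² + 1` and the `β`-independent weight
`D = 4096 (C_A C_B + 1) (|A|+1)(|B|+1) e^{n₀}`. -/
theorem final_bound {x CA CB K c μr : ℝ} {wA wB nA nB n : ℕ} (hCA0 : 0 ≤ CA) (hCB0 : 0 ≤ CB)
    (hap : x ≤ 2 * (CA * CB))
    (hmain : 2 * (wA + wB) + 8 ≤ n →
      x ≤ max K 0 * ((max c 0) ^ 2 * (CA * CB) * ((64 * nA) * (64 * nB))) *
        Real.exp (-(μr * (n - (2 * (wA + wB) + 8) : ℕ)))) :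
    x ≤ (max K 0 * (max c 0) ^ 2 + 1) *
      (4096 * (CA * CB + 1) * (((nA : ℝ) + 1) * ((nB : ℝ) + 1)) *
        Real.exp ((2 * (wA + wB) + 8 : ℕ) : ℝ)) *
      Real.exp (-(min μr 1 * n)) := by
  set n₀ : ℕ := 2 * (wA + wB) + 8 with hn₀
  set m : ℝ := min μr 1 with hm
  have hm1 : m ≤ 1 := min_le_right _ _
  have hmμ : m ≤ μr := min_le_left _ _
  have hK'0 : 0 ≤ max K 0 * (max c 0) ^ 2 := by positivity
  have hK'1 : 1 ≤ max K 0 * (max c 0) ^ 2 + 1 := le_add_of_nonneg_left hK'0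
  set D : ℝ := 4096 * (CA * CB + 1) * (((nA : ℝ) + 1) * ((nB : ℝ) + 1)) * Real.exp (n₀ : ℝ) with hD
  have hD0 : 0 ≤ D := by positivity
  by_cases hn : n₀ ≤ n
  · have h := hmain hn
    have hk : ((n - n₀ : ℕ) : ℝ) = n - n₀ := by rw [Nat.cast_sub hn]
    have hexp : Real.exp (-(μr * (n - n₀ : ℕ))) ≤ Real.exp (n₀ : ℝ) * Real.exp (-(m * n)) := by
      rw [← Real.exp_add, hk]
      refine Real.exp_le_exp.2 ?_
      have h0 : (0 : ℝ) ≤ n - n₀ := by rw [← hk]; exact Nat.cast_nonneg _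
      have h1 : m * (n - n₀) ≤ μr * (n - n₀) := mul_le_mul_of_nonneg_right hmμ h0
      have h2 : m * n₀ ≤ 1 * n₀ := mul_le_mul_of_nonneg_right hm1 (Nat.cast_nonneg _)
      linarith
    calc x ≤ max K 0 * ((max c 0) ^ 2 * (CA * CB) * ((64 * nA) * (64 * nB))) *
          Real.exp (-(μr * (n - n₀ : ℕ))) := h
      _ ≤ max K 0 * ((max c 0) ^ 2 * (CA * CB) * ((64 * nA) * (64 * nB))) *
          (Real.exp (n₀ : ℝ) * Real.exp (-(m * n))) := mul_le_mul_of_nonneg_left hexp (by positivity)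
      _ = (max K 0 * (max c 0) ^ 2) * ((4096 * (CA * CB) * ((nA : ℝ) * nB)) * Real.exp (n₀ : ℝ)) *
          Real.exp (-(m * n)) := by ring
      _ ≤ (max K 0 * (max c 0) ^ 2 + 1) * D * Real.exp (-(m * n)) := by
          refine mul_le_mul_of_nonneg_right ?_ (Real.exp_pos _).le
          refine mul_le_mul (le_add_of_nonneg_right zero_le_one) ?_ (by positivity) (by positivity)
          refine mul_le_mul_of_nonneg_right ?_ (Real.exp_pos _).le
          refine mul_le_mul (mul_le_mul_of_nonneg_left (le_add_of_nonneg_right zero_le_one) (by norm_num))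
            ?_ (by positivity) (by positivity)
          exact mul_le_mul (le_add_of_nonneg_right zero_le_one) (le_add_of_nonneg_right zero_le_one)
            (by positivity) (by positivity)
  · have hn' : n < n₀ := Nat.lt_of_not_le hn
    have hexp : Real.exp (-(n₀ : ℝ)) ≤ Real.exp (-(m * n)) := by
      refine Real.exp_le_exp.2 (neg_le_neg ?_)
      have h1 : (n : ℝ) ≤ n₀ := by exact_mod_cast hn'.le
      have h2 : m * n ≤ 1 * n := mul_le_mul_of_nonneg_right hm1 (Nat.cast_nonneg _)
      linarith
    have hQ : (1 : ℝ) ≤ ((nA : ℝ) + 1) * ((nB : ℝ) + 1) :=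
      one_le_mul_of_one_le_of_one_le (le_add_of_nonneg_left (Nat.cast_nonneg _))
        (le_add_of_nonneg_left (Nat.cast_nonneg _))
    have hP : 0 ≤ CA * CB := mul_nonneg hCA0 hCB0
    calc x ≤ 2 * (CA * CB) := hap
      _ ≤ 4096 * (CA * CB + 1) * 1 := by linarith
      _ ≤ 4096 * (CA * CB + 1) * (((nA : ℝ) + 1) * ((nB : ℝ) + 1)) :=
          mul_le_mul_of_nonneg_left hQ (by positivity)
      _ = D * Real.exp (-(n₀ : ℝ)) := by
          rw [hD, mul_assoc _ (Real.exp _) _, ← Real.exp_add, add_neg_cancel, Real.exp_zero, mul_one]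
      _ ≤ D * Real.exp (-(m * n)) := mul_le_mul_of_nonneg_left hexp hD0
      _ ≤ (max K 0 * (max c 0) ^ 2 + 1) * (D * Real.exp (-(m * n))) :=
          le_mul_of_one_le_left (mul_nonneg hD0 (Real.exp_pos _).le) hK'1
      _ = (max K 0 * (max c 0) ^ 2 + 1) * D * Real.exp (-(m * n)) := (mul_assoc _ _ _).symm

/-- `stub_speciesClustering` — **from Lipschitz covariance decay to per-β clustering of all species with a
β-independent observable weight** (P2; provable now, size L).  If at every `β ≥ β₁` one heat-bath step
regularises with constant `c(β)` (P1) and Lipschitz cylinder functions cluster in the cyclic time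
separation with `(μ(β), K(β), S₀(β))` (H), then there are a `β`-INDEPENDENT weight `D(A,B)` and, for every
`β ≥ β₁`, a rate `m(β) > 0`, a prefactor `K'(β)` and a threshold `S₁(β)` with
`|corr_{β,2S+1}(A,B,n)| ≤ K'(β) D(A,B) e^{−m(β) n}` for all species `A, B`, `S ≥ S₁(β)`, `n ≤ S`.
Proof: write the correlation through the shifted periodic lifts (`latticeConnectedCorr_eq_integral_sub`,
`shiftedObservable_props`); replace `f = A.F ∘ lift` and `τ_n g` by their P1-versions `f̃, g̃` on the collars
`T_A, T_B` (pull-out, `Measurable.measurable_cylinderEvents_of_dependsOn`, valid once the collars and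
supports are time-disjoint, i.e. `n ≥ w_A + w_B + 4`, `w` = time extent of the support); apply H with
`K_f = c C_A`, `K_g = c C_B`, cyclic separation `k = n − w_A − w_B − 4` (the other way round the cycle is
longer since `n ≤ S`); use the rate `m = min μ 1` so that `e^{m(w_A+w_B+4)} ≤ e^{w_A+w_B+4}` is
`β`-independent; small `n` and small `S` (supports wrapping) by the a priori bound
`abs_latticeConnectedCorr_le_two_mul` with the `β`-independent weight `2 C_A C_B e^{S(A,B)}`. -/
theorem stub_speciesClustering :
    ∀ (G : Type) [Group G] [TopologicalSpace G] [IsTopologicalGroup G] [CompactSpace G]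
      [MeasurableSpace G] [BorelSpace G] (r : LatticeRep G) (β₁ : ℝ),
    (∀ β : ℝ, β₁ ≤ β →
      ∃ c : ℝ, ∀ (S : ℕ) (Λ T : Finset (Edge 4 (2 * S + 1))), Disjoint Λ T →
      (∀ (y : Site 4 (2 * S + 1)) (i j : Fin 4), i < j →
        (({(y, i), (y.shift i, j), (y.shift j, i), (y, j)} : Finset (Edge 4 (2 * S + 1))) ∩ Λ).Nonempty →
        (↑({(y, i), (y.shift i, j), (y.shift j, i), (y, j)} : Finset (Edge 4 (2 * S + 1))) :
          Set (Edge 4 (2 * S + 1))) ⊆ ↑Λ ∪ ↑T) →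
      ∀ (f : GaugeConfig 4 (2 * S + 1) G → ℝ) (M : ℝ), Measurable f → (∀ U, |f U| ≤ M) →
        DependsOn f (↑Λ : Set (Edge 4 (2 * S + 1))) →
      ∃ f' : GaugeConfig 4 (2 * S + 1) G → ℝ, Measurable f' ∧ (∀ U, |f' U| ≤ M) ∧
        DependsOn f' (↑T : Set (Edge 4 (2 * S + 1))) ∧
        (∀ (U : GaugeConfig 4 (2 * S + 1) G) (e : Edge 4 (2 * S + 1)) (h : G),
          |f' (Function.update U e h) - f' U| ≤
            c * M * Real.sqrt (∑ a, ∑ b, ‖(r.ρ h - r.ρ (U e)) a b‖ ^ 2)) ∧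
        f' =ᵐ[(wilsonMeasure r.ρ β : Measure (GaugeConfig 4 (2 * S + 1) G))]
          (wilsonMeasure r.ρ β : Measure (GaugeConfig 4 (2 * S + 1) G))[f | cylinderEvents ((↑Λ : Set (Edge 4 (2 * S + 1)))ᶜ)]) →
    (∀ β : ℝ, β₁ ≤ β →
      ∃ μ : ℝ, 0 < μ ∧ ∃ K : ℝ, ∃ S₀ : ℕ, ∀ S : ℕ, S₀ ≤ S →
      ∀ (f g : GaugeConfig 4 (2 * S + 1) G → ℝ) (Λf Λg : Finset (Edge 4 (2 * S + 1))) (Kf Kg : ℝ),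
        0 ≤ Kf → 0 ≤ Kg → Measurable f → Measurable g →
        (∃ M : ℝ, ∀ U, |f U| ≤ M) → (∃ M : ℝ, ∀ U, |g U| ≤ M) →
        DependsOn f (↑Λf : Set (Edge 4 (2 * S + 1))) → DependsOn g (↑Λg : Set (Edge 4 (2 * S + 1))) →
        (∀ (U : GaugeConfig 4 (2 * S + 1) G) (e : Edge 4 (2 * S + 1)) (h : G),
          |f (Function.update U e h) - f U| ≤ Kf * Real.sqrt (∑ a, ∑ b, ‖(r.ρ h - r.ρ (U e)) a b‖ ^ 2)) →
        (∀ (U : GaugeConfig 4 (2 * S + 1) G) (e : Edge 4 (2 * S + 1)) (h : G),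
          |g (Function.update U e h) - g U| ≤ Kg * Real.sqrt (∑ a, ∑ b, ‖(r.ρ h - r.ρ (U e)) a b‖ ^ 2)) →
      ∀ k : ℕ, (∀ e ∈ Λf, ∀ e' ∈ Λg, k ≤ (e.1 0 - e'.1 0).val ∧ k ≤ (e'.1 0 - e.1 0).val) →
        |(∫ U, f U * g U ∂(wilsonMeasure r.ρ β : Measure (GaugeConfig 4 (2 * S + 1) G))) -
            (∫ U, f U ∂(wilsonMeasure r.ρ β : Measure (GaugeConfig 4 (2 * S + 1) G))) *
              ∫ U, g U ∂(wilsonMeasure r.ρ β : Measure (GaugeConfig 4 (2 * S + 1) G))| ≤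
          K * Kf * Kg * Λf.card * Λg.card * Real.exp (-(μ * k))) →
    ∃ D : YMSpecies G → YMSpecies G → ℝ, ∀ β : ℝ, β₁ ≤ β →
      ∃ m : ℝ, 0 < m ∧ ∃ K : ℝ, ∃ S₁ : ℕ, ∀ (A B : YMSpecies G) (S n : ℕ), S₁ ≤ S → n ≤ S →
        |latticeConnectedCorr r.ρ β (2 * S + 1) A.F B.F n| ≤ K * D A B * Real.exp (-(m * n)) := by
  intro G _ _ _ _ _ _ r β₁ hP1 hH
  refine ⟨fun A B => 4096 * (A.bounded.choose * B.bounded.choose + 1) *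
      (((A.supp.card : ℝ) + 1) * ((B.supp.card : ℝ) + 1)) *
      Real.exp ((2 * ((A.supp.sup fun e => (e.1 0).natAbs) + (B.supp.sup fun e => (e.1 0).natAbs)) + 8 :
        ℕ) : ℝ), fun β hβ => ?_⟩
  obtain ⟨c, hc⟩ := hP1 β hβ
  obtain ⟨μr, hμr, K, S₀, hK⟩ := hH β hβ
  refine ⟨min μr 1, lt_min hμr one_pos, max K 0 * (max c 0) ^ 2 + 1, S₀, fun A B S n hS hnS => ?_⟩
  have hCA := A.bounded.choose_spec
  have hCB := B.bounded.choose_spec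
  have hCA0 : 0 ≤ A.bounded.choose := (abs_nonneg _).trans (hCA 1)
  have hCB0 : 0 ≤ B.bounded.choose := (abs_nonneg _).trans (hCB 1)
  have hwA : ∀ e ∈ A.supp, (e.1 0).natAbs ≤ A.supp.sup fun e => (e.1 0).natAbs := fun e he =>
    Finset.le_sup (f := fun e : Literature.MathematicalPhysics.QuantumLattice.ZdEdge 4 => (e.1 0).natAbs) he
  have hwB : ∀ e ∈ B.supp, (e.1 0).natAbs ≤ B.supp.sup fun e => (e.1 0).natAbs := fun e he =>
    Finset.le_sup (f := fun e : Literature.MathematicalPhysics.QuantumLattice.ZdEdge 4 => (e.1 0).natAbs) he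
  exact final_bound hCA0 hCB0 (abs_latticeConnectedCorr_le_two_mul r β (2 * S + 1) hCA hCB n)
    (fun hn₀ => abs_corr_le_main r β A B hCA hCB hwA hwB (hc S) (hK S hS) hn₀ hnS)

end Summit.QuantumFields.YangMills.Theorems.LatticeGapLargeBeta.WittenIMS

end
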